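import Mathlib
import HarnessLib
import Summits.AtomisticToContinuum.FouriersLaw.Theses.JunctionLocality
import Summits.AtomisticToContinuum.FouriersLaw.Theorems.JunctionLocalityConductanceLowerBoundFloorEquivalence
import Summits.AtomisticToContinuum.FouriersLaw.Theorems.JunctionLocalityConductanceLowerBoundHelperCouplingTransfer

/-!
# Strategy census, generation 2, for crux `JunctionLocality.ConductanceLowerBound` (stmt-AtomisticToContinuum-11749) —
typed companion of `STRATEGY-CENSUS.md` §s2 (crux-strategist seat `cstrat-stmt-AtomisticToContinuum-11749-s2`, 2026-08-17)

Like generation 1 (`StrategyCensus.lean`), this file only TYPES the statements named in the census and proves the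
elementary implications the census quotes.  Nothing here is a line (no `stub_*`, no registered composition); the live
skeleton is untouched.

Contents
* §0 `InFrame Φ` — the crux's quantifier frame applied to a property `Φ` of the response sequence `D`;
  `ConductanceLowerBound`/`PositiveConductance` are `InFrame` of their conclusions (`Iff.rfl`).
* §1 Sequence lemmas (pure real analysis): iterated dyadic halving, dyadic anchors, and
  `lowerBound_of_dyadicHalving_of_windowGrowth`.
* §2 Strengthening S6 / decomposition D-H: `DyadicHalving` (`G_{2N} ≥ ½ G_N (1 − C/N)`, conductance `G_N = D_N/(N−1)`,
  stated in the `D`-form `(1 − C/N) D_N ≤ D_{2N}`) and `WindowSlowGrowth` (`D_L ≤ K·D_M` for `M ≤ L ≤ 2M`), with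
  `conductanceLowerBound_of_dyadicHalving_of_windowSlowGrowth :
     DyadicHalving → WindowSlowGrowth → PositiveConductance → ConductanceLowerBound` (PROVED).
* §3 Decomposition D-G: `PowerLawFloor a` (`D_N ≥ c/N^a`), the bridge `Bootstrap a := PowerLawFloor a → crux`, and the
  weak-contact transmission statement `WeakContactTransmission` (relative transmission `𝒯_L = 4γ'²‖∂_{p_{L−1}}g'‖²/T ≥ t₀`
  at the length-scaled coupling `γ' = γ₀/L`), with
  `powerLawFloor_one_of_weakContactTransmission : WeakContactTransmission → PowerLawFloor 1` (PROVED from the landed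
  coupling transfer `helper_couplingTransfer_farGradient` and `response_eq_dirichlet`): the scaled weak-contact transfer
  loses exactly one power of `L`.
* §4 Strengthen S7 (structural): `multiplicativeSeriesLaw_witness` — a resistance sequence obeying the series law with
  MULTIPLICATIVE slack `R_{N+M} ≤ 2(R_N + R_M)` whose `D_N = (N−1)/R_N → 0`: multiplicative slack cannot supply the crux.
-/

noncomputable section

open MeasureTheory Filter Topology
open scoped ContDiff
open Literature.MathematicalPhysics.KineticTheory.HeatConduction
open Summit.AtomisticToContinuum.FouriersLaw.Theorems.SuperadditiveResistance.DeviceLiouville (kin)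
open Summit.AtomisticToContinuum.FouriersLaw.Cruxes.SuperadditiveResistance.FloatingProbeBypassLaplacian
  (stub_plainForwardField)
open Summit.AtomisticToContinuum.FouriersLaw.Cruxes.ConductanceLowerBound.ForecastSensitivity
  (response_eq_dirichlet helper_couplingTransfer_farGradient)

namespace Summit.AtomisticToContinuum.FouriersLaw.Cruxes.ConductanceLowerBound.StrategyCensusS2JLb

open Summit.AtomisticToContinuum.FouriersLaw.Theses.JunctionLocality

/-! ## §0 The crux frame -/

/-- The quantifier frame of the crux (parameters `> 0`, weak-NESS uniqueness antecedent, a steady-state family, `T > 0`,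
its response coefficients `D`) applied to a property `Φ` of the response sequence. -/
def InFrame (Φ : (ℕ → ℝ) → Prop) : Prop :=
  ∀ ω₂ lam β γ : ℝ, 0 < ω₂ → 0 < lam → 0 < β → 0 < γ →
    (∀ (N : ℕ) (T_L T_R : ℝ), 0 < T_L → 0 < T_R → ∀ μ ν : Measure (PhaseSpace N),
      (pinnedChain ω₂ lam β γ).IsSteadyState N T_L T_R μ →
      (pinnedChain ω₂ lam β γ).IsSteadyState N T_L T_R ν → μ = ν) →
    ∀ μ : (N : ℕ) → ℝ → ℝ → Measure (PhaseSpace N),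
      (∀ (N : ℕ) (T_L T_R : ℝ), 0 < T_L → 0 < T_R →
        (pinnedChain ω₂ lam β γ).IsSteadyState N T_L T_R (μ N T_L T_R)) →
      ∀ T : ℝ, 0 < T → ∀ D : ℕ → ℝ,
        (∀ N : ℕ, Tendsto (fun δ : ℝ =>
          (pinnedChain ω₂ lam β γ).totalCurrent (μ N (T + δ / 2) (T - δ / 2)) / δ)
            (𝓝[≠] 0) (𝓝 (D N))) → Φ D

/-- The crux is its frame applied to `∃ c > 0 ∃ N₁ ∀ N ≥ N₁, c ≤ D N`. -/
theorem conductanceLowerBound_iff_inFrame :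
    ConductanceLowerBound ↔ InFrame (fun D => ∃ c : ℝ, 0 < c ∧ ∃ N₁ : ℕ, ∀ N : ℕ, N₁ ≤ N → c ≤ D N) :=
  Iff.rfl

/-- `PositiveConductance` (closed item stmt-11750) is the frame applied to `∀ N ≥ 2, 0 < D N`. -/
theorem positiveConductance_iff_inFrame :
    PositiveConductance ↔ InFrame (fun D => ∀ N : ℕ, 2 ≤ N → 0 < D N) :=
  Iff.rfl

/-- Pointwise combination inside the frame (two hypotheses). -/
theorem inFrame_mp₂ {Φ Ψ Ξ : (ℕ → ℝ) → Prop} (h : ∀ D, Φ D → Ψ D → Ξ D) :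
    InFrame Φ → InFrame Ψ → InFrame Ξ := by
  intro hΦ hΨ ω₂ lam β γ hω hl hβ hγ hu μ hμ T hT D hD
  exact h D (hΦ ω₂ lam β γ hω hl hβ hγ hu μ hμ T hT D hD) (hΨ ω₂ lam β γ hω hl hβ hγ hu μ hμ T hT D hD)

/-- Pointwise combination inside the frame (three hypotheses). -/
theorem inFrame_mp₃ {Φ Ψ Θ Ξ : (ℕ → ℝ) → Prop} (h : ∀ D, Φ D → Ψ D → Θ D → Ξ D) :
    InFrame Φ → InFrame Ψ → InFrame Θ → InFrame Ξ := by
  intro hΦ hΨ hΘ ω₂ lam β γ hω hl hβ hγ hu μ hμ T hT D hD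
  exact h D (hΦ ω₂ lam β γ hω hl hβ hγ hu μ hμ T hT D hD) (hΨ ω₂ lam β γ hω hl hβ hγ hu μ hμ T hT D hD)
    (hΘ ω₂ lam β γ hω hl hβ hγ hu μ hμ T hT D hD)

/-! ## §1 Sequence lemmas -/

section Seq

variable {D : ℕ → ℝ}

/-- Iterated dyadic halving.  With `x = C/N ∈ [0, 1/4]` the invariant is
`D (2^k N) ≥ (1 − 2x + 2x/2^k) · D N`; the step uses `(1 − a)(1 − 2x + 2a) ≥ 1 − 2x + a` for `a = x/2^k ≤ x`. -/
theorem dyadic_iterate {C : ℝ} (hC : 0 ≤ C) {N₁ : ℕ} (hN₁ : 1 ≤ N₁) (hCN : 4 * C ≤ (N₁ : ℝ))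
    (hpos : ∀ N : ℕ, N₁ ≤ N → 0 ≤ D N)
    (hH : ∀ N : ℕ, N₁ ≤ N → (1 - C / N) * D N ≤ D (2 * N)) :
    ∀ (k N : ℕ), N₁ ≤ N → (1 - 2 * (C / N) + 2 * (C / N) / 2 ^ k) * D N ≤ D (2 ^ k * N) := by
  intro k
  induction k with
  | zero =>
    intro N hN
    have : (1 - 2 * (C / N) + 2 * (C / N) / 2 ^ 0) * D N = D (2 ^ 0 * N) := by
      rw [pow_zero, pow_zero, one_mul]; ring
    exact this.le
  | succ k ih =>
    intro N hN
    have hNpos : (0 : ℝ) < N := by exact_mod_cast (show 0 < N by omega)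
    set x : ℝ := C / N with hx
    have hx0 : 0 ≤ x := div_nonneg hC hNpos.le
    have hx4 : x ≤ 1 / 4 := by
      rw [hx, div_le_iff₀ hNpos]
      have : (N₁ : ℝ) ≤ N := by exact_mod_cast hN
      linarith
    have h2k : (1 : ℝ) ≤ 2 ^ k := one_le_pow₀ (by norm_num)
    have h2kpos : (0 : ℝ) < 2 ^ k := by positivity
    set a : ℝ := x / 2 ^ k with ha
    have ha0 : 0 ≤ a := div_nonneg hx0 h2kpos.le
    have hax : a ≤ x := div_le_self hx0 h2k
    -- the halving step at length 2^k N
    have hkN : N₁ ≤ 2 ^ k * N := le_trans hN (Nat.le_mul_of_pos_left N (Nat.two_pow_pos k))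
    have hstep := hH (2 ^ k * N) hkN
    have hcast : (C / ((2 ^ k * N : ℕ) : ℝ)) = a := by
      rw [ha, hx]; push_cast
      field_simp
    rw [hcast, show 2 * (2 ^ k * N) = 2 ^ (k + 1) * N by ring] at hstep
    -- hstep : (1 - a) * D (2^k N) ≤ D (2^(k+1) N)
    have hIH := ih N hN
    -- hIH : (1 - 2x + 2x/2^k) * D N ≤ D (2^k N), and 2x/2^k = 2a
    have h2a : 2 * x / 2 ^ k = 2 * a := by rw [ha]; ring
    rw [h2a] at hIH
    have hDN : 0 ≤ D N := hpos N hN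
    have h1a : 0 ≤ 1 - a := by linarith
    have hcoef : (1 - 2 * x + 2 * x / 2 ^ (k + 1)) = 1 - 2 * x + a := by
      rw [ha, pow_succ]; ring
    rw [hcoef]
    have hineq : (1 - 2 * x + a) ≤ (1 - a) * (1 - 2 * x + 2 * a) := by
      nlinarith [mul_nonneg ha0 (sub_nonneg.2 hax)]
    calc (1 - 2 * x + a) * D N ≤ (1 - a) * (1 - 2 * x + 2 * a) * D N :=
          mul_le_mul_of_nonneg_right hineq hDN
      _ = (1 - a) * ((1 - 2 * x + 2 * a) * D N) := by ring
      _ ≤ (1 - a) * D (2 ^ k * N) := mul_le_mul_of_nonneg_left hIH h1a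
      _ ≤ D (2 ^ (k + 1) * N) := hstep

/-- Consequence: along the dyadic tower over any `N ≥ N₁` the response never drops below half its base value. -/
theorem dyadic_half {C : ℝ} (hC : 0 ≤ C) {N₁ : ℕ} (hN₁ : 1 ≤ N₁) (hCN : 4 * C ≤ (N₁ : ℝ))
    (hpos : ∀ N : ℕ, N₁ ≤ N → 0 ≤ D N)
    (hH : ∀ N : ℕ, N₁ ≤ N → (1 - C / N) * D N ≤ D (2 * N)) :
    ∀ (k N : ℕ), N₁ ≤ N → D N / 2 ≤ D (2 ^ k * N) := by
  intro k N hN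
  have hNpos : (0 : ℝ) < N := by exact_mod_cast (show 0 < N by omega)
  have hx0 : 0 ≤ C / N := div_nonneg hC hNpos.le
  have hx4 : C / N ≤ 1 / 4 := by
    rw [div_le_iff₀ hNpos]
    have : (N₁ : ℝ) ≤ N := by exact_mod_cast hN
    linarith
  have h2kpos : (0 : ℝ) < 2 ^ k := by positivity
  have hterm : 0 ≤ 2 * (C / N) / 2 ^ k := by positivity
  have hDN : 0 ≤ D N := hpos N hN
  have hcoef : (1 : ℝ) / 2 ≤ 1 - 2 * (C / N) + 2 * (C / N) / 2 ^ k := by linarith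
  calc D N / 2 = (1 / 2) * D N := by ring
    _ ≤ (1 - 2 * (C / N) + 2 * (C / N) / 2 ^ k) * D N := mul_le_mul_of_nonneg_right hcoef hDN
    _ ≤ D (2 ^ k * N) := dyadic_iterate hC hN₁ hCN hpos hH k N hN

/-- Dyadic anchors: every `M ≥ N₀ ≥ 1` has a point of the tower `{2^k N : N₀ ≤ N ≤ 2N₀}` in `(M, 2M]`. -/
theorem exists_dyadic_anchor {N₀ : ℕ} (hN₀ : 1 ≤ N₀) {M : ℕ} (hM : N₀ ≤ M) :
    ∃ k N : ℕ, N₀ ≤ N ∧ N ≤ 2 * N₀ ∧ M < 2 ^ k * N ∧ 2 ^ k * N ≤ 2 * M := by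
  have hex : ∃ k : ℕ, M < 2 ^ (k + 1) * N₀ := by
    refine ⟨M, ?_⟩
    calc M < 2 ^ M := Nat.lt_two_pow_self
      _ ≤ 2 ^ (M + 1) := Nat.pow_le_pow_right (by norm_num) (Nat.le_succ M)
      _ ≤ 2 ^ (M + 1) * N₀ := Nat.le_mul_of_pos_right _ hN₀
  classical
  set k := Nat.find hex with hk
  have hk_spec : M < 2 ^ (k + 1) * N₀ := Nat.find_spec hex
  have hk_low : 2 ^ k * N₀ ≤ M := by
    rcases Nat.eq_zero_or_pos k with h0 | hpos
    · rw [h0, pow_zero, one_mul]; exact hM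
    · obtain ⟨k', hk'⟩ : ∃ k', k = k' + 1 := ⟨k - 1, by omega⟩
      have hmin : ¬ M < 2 ^ (k' + 1) * N₀ := Nat.find_min hex (by omega)
      rw [hk']; omega
  have h2k : 0 < 2 ^ k := Nat.two_pow_pos k
  refine ⟨k, M / 2 ^ k + 1, ?_, ?_, ?_, ?_⟩
  · have : N₀ ≤ M / 2 ^ k := (Nat.le_div_iff_mul_le h2k).2 (by simpa [mul_comm] using hk_low)
    omega
  · have : M / 2 ^ k < 2 * N₀ := by
      refine (Nat.div_lt_iff_lt_mul h2k).2 ?_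
      calc M < 2 ^ (k + 1) * N₀ := hk_spec
        _ = 2 * N₀ * 2 ^ k := by ring
    omega
  · exact Nat.lt_mul_div_succ M h2k
  · have h1 : 2 ^ k * (M / 2 ^ k) ≤ M := Nat.mul_div_le M (2 ^ k)
    have h2 : 2 ^ k ≤ M := le_trans (Nat.le_mul_of_pos_right _ hN₀) hk_low
    calc 2 ^ k * (M / 2 ^ k + 1) = 2 ^ k * (M / 2 ^ k) + 2 ^ k := by ring
      _ ≤ M + M := Nat.add_le_add h1 h2
      _ = 2 * M := by ring

/-- **Sequence-level glue of §2.**  Positivity from `N = 2` on, dyadic halving `(1 − C/N) D_N ≤ D_{2N}` (eventually) and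
window slow growth `D_L ≤ K D_M` (`M ≤ L ≤ 2M`, eventually) give `liminf_N D_N > 0`. -/
theorem lowerBound_of_dyadicHalving_of_windowGrowth
    (hP : ∀ N : ℕ, 2 ≤ N → 0 < D N)
    (hH : ∃ C : ℝ, ∃ N₁ : ℕ, ∀ N : ℕ, N₁ ≤ N → (1 - C / N) * D N ≤ D (2 * N))
    (hW : ∃ K : ℝ, ∃ N₁ : ℕ, ∀ M L : ℕ, N₁ ≤ M → M ≤ L → L ≤ 2 * M → D L ≤ K * D M) :
    ∃ c : ℝ, 0 < c ∧ ∃ N₂ : ℕ, ∀ N : ℕ, N₂ ≤ N → c ≤ D N := by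
  obtain ⟨C, N₁, hH⟩ := hH
  obtain ⟨K, N₁', hW⟩ := hW
  -- normalise the halving constant to C' = max C 0 ≥ 0
  set C' : ℝ := max C 0 with hC'
  have hC'0 : 0 ≤ C' := le_max_right _ _
  -- a common threshold N₀ ≥ 2, N₁, N₁', 4C'
  set N₀ : ℕ := max (max N₁ N₁') (max 2 (⌈4 * C'⌉₊)) with hN₀
  have hN₀1 : N₁ ≤ N₀ := le_trans (le_max_left _ _) (le_max_left _ _)
  have hN₀1' : N₁' ≤ N₀ := le_trans (le_max_right _ _) (le_max_left _ _)
  have hN₀2 : 2 ≤ N₀ := le_trans (le_max_left _ _) (le_max_right _ _)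
  have hN₀C : 4 * C' ≤ (N₀ : ℝ) := by
    have h1 : 4 * C' ≤ (⌈4 * C'⌉₊ : ℝ) := Nat.le_ceil _
    have h2 : (⌈4 * C'⌉₊ : ℕ) ≤ N₀ := le_trans (le_max_right _ _) (le_max_right _ _)
    exact h1.trans (by exact_mod_cast h2)
  have hpos : ∀ N : ℕ, N₀ ≤ N → 0 ≤ D N := fun N hN => (hP N (hN₀2.trans hN)).le
  have hH' : ∀ N : ℕ, N₀ ≤ N → (1 - C' / N) * D N ≤ D (2 * N) := by
    intro N hN
    have hNpos : (0 : ℝ) < N := by exact_mod_cast (show 0 < N by omega)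
    have hDN : 0 ≤ D N := hpos N hN
    have hCC : C ≤ C' := le_max_left _ _
    calc (1 - C' / N) * D N ≤ (1 - C / N) * D N := by
          apply mul_le_mul_of_nonneg_right _ hDN
          have : C / N ≤ C' / N := div_le_div_of_nonneg_right hCC hNpos.le
          linarith
      _ ≤ D (2 * N) := hH N (hN₀1.trans hN)
  -- K ≥ 1 > 0 (from the window at M = L = N₀)
  have hK : 0 < K := by
    have h := hW N₀ N₀ hN₀1' le_rfl (by omega)
    have hD0 : 0 < D N₀ := hP N₀ hN₀2
    nlinarith
  -- the base block minimum m = min {D N : N₀ ≤ N ≤ 2 N₀} > 0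
  obtain ⟨Nm, hNm_mem, hNm_min⟩ :=
    (Finset.Icc N₀ (2 * N₀)).exists_min_image D ⟨N₀, Finset.mem_Icc.2 ⟨le_rfl, by omega⟩⟩
  have hNm0 : N₀ ≤ Nm := (Finset.mem_Icc.1 hNm_mem).1
  set m : ℝ := D Nm with hm
  have hm_pos : 0 < m := hP Nm (hN₀2.trans hNm0)
  refine ⟨m / (2 * K), by positivity, N₀, fun M hM => ?_⟩
  obtain ⟨k, N, hN0, hN2, hMA, hAM⟩ := exists_dyadic_anchor (by omega : 1 ≤ N₀) hM
  -- anchor A = 2^k N with M < A ≤ 2M, and D A ≥ D N / 2 ≥ m / 2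
  have hA : D N / 2 ≤ D (2 ^ k * N) := dyadic_half hC'0 (by omega : 1 ≤ N₀) hN₀C hpos hH' k N hN0
  have hmN : m ≤ D N := hNm_min N (Finset.mem_Icc.2 ⟨hN0, hN2⟩)
  have hwin : D (2 ^ k * N) ≤ K * D M := hW M (2 ^ k * N) (hN₀1'.trans hM) hMA.le hAM
  rw [div_le_iff₀ (by positivity : (0 : ℝ) < 2 * K)]
  nlinarith

end Seq

/-! ## §2 S6 / D-H: dyadic halving and window slow growth -/

/-- **S6 — DYADIC HALVING** (census §Strengthen S6 and §Decomposition D-H).  In the crux frame: there are `C` and `N₁`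
with `(1 − C/N)·D_N ≤ D_{2N}` for all `N ≥ N₁`; since `(2N−1)/(2(N−1)) ≥ 1` this is implied by the conductance form
`G_{2N} ≥ ½·G_N·(1 − C/N)` (`G_N = D_N/(N−1)`): doubling a reflection-symmetric chain at most halves its conductance, up
to a relative `O(1/N)`.  In the Markov caricature (energy a random walker, baths absorbing) it is EXACT by the strong
Markov property at the first visit to the midpoint plus reflection symmetry (exit either side with probability `½`);
NEMD (kit j021937, 5 regimes, `N ≤ 128`): `R_{2N} < 2R_N` throughout (positive contact resistance), so it holds there with
`C = 0`.  It FAILS for every insulator, exponential (`G_{2N}/G_N ∼ e^{−cN}`) or power-law (`∼ 2^{−1−a}`): its content is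
the crux's, in a two-length comparative form at the symmetric cut (the subadditive twin of (A) at `M = N`). -/
def DyadicHalving : Prop :=
  InFrame (fun D => ∃ C : ℝ, ∃ N₁ : ℕ, ∀ N : ℕ, N₁ ≤ N → (1 - C / N) * D N ≤ D (2 * N))

/-- **WINDOW SLOW GROWTH** (census D-H, the "soft" piece).  In the crux frame: there are `K` and `N₁` with
`D_L ≤ K·D_M` whenever `N₁ ≤ M ≤ L ≤ 2M` — doubling the length multiplies the response coefficient by at most `K`.
Insulators satisfy it (`D` decreasing); it is implied by two-sided junction locality with the `1/N` rate
(`|D_N − κ| ≤ K'/N`), not by `FouriersLaw` alone (no rate); NEMD j021937: `D_{2N}/D_N ∈ [1.6, 2.4]` decreasing towards `1`.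
It does NOT imply the crux (`D_N = 1/N` satisfies it). -/
def WindowSlowGrowth : Prop :=
  InFrame (fun D => ∃ K : ℝ, ∃ N₁ : ℕ, ∀ M L : ℕ, N₁ ≤ M → M ≤ L → L ≤ 2 * M → D L ≤ K * D M)

/-- **`DyadicHalving → WindowSlowGrowth → PositiveConductance → ConductanceLowerBound`** (census D-H: the glue of the
best two-piece typed split of generation 2; `PositiveConductance` is the CLOSED item stmt-11750).  Proof: the
sequence lemma `lowerBound_of_dyadicHalving_of_windowGrowth` inside the frame. -/
theorem conductanceLowerBound_of_dyadicHalving_of_windowSlowGrowth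
    (hH : DyadicHalving) (hW : WindowSlowGrowth) (hP : PositiveConductance) : ConductanceLowerBound := by
  rw [conductanceLowerBound_iff_inFrame]
  rw [positiveConductance_iff_inFrame] at hP
  exact inFrame_mp₃ (fun D h1 h2 h3 => lowerBound_of_dyadicHalving_of_windowGrowth h3 h1 h2) hH hW hP

/-! ## §3 D-G: power-law floor, bootstrap bridge, weak-contact transmission -/

/-- **POWER-LAW FLOOR of order `a`** (census D-G): in the crux frame, `D_N ≥ c/N^a` eventually.  For `a = 0` it is the
crux; for `a ≥ 1` it allows power-law subdiffusion (`G_N = D_N/(N−1) ≳ N^{−1−a}`) and excludes only super-polynomial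
(e.g. exponential) insulation.  No polynomial lower bound on the transport of ANY deterministic anharmonic chain is in
print (De Roeck–Huveneers programme: upper bounds only). -/
def PowerLawFloor (a : ℕ) : Prop :=
  InFrame (fun D => ∃ c : ℝ, 0 < c ∧ ∃ N₁ : ℕ, ∀ N : ℕ, N₁ ≤ N → c / (N : ℝ) ^ a ≤ D N)

/-- **BOOTSTRAP bridge of order `a`** (census D-G): "at most polynomially slow ⇒ not slow at all".  A conditional with no
known mechanism (a clean chain is not expected to be subdiffusive — Basko 2011; De Roeck–Huveneers–Olla 2020 §1.2 — but
nothing structural excludes `2 < z < ∞`). -/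
def Bootstrap (a : ℕ) : Prop := PowerLawFloor a → ConductanceLowerBound

/-- The crux implies every power-law floor (so `Bootstrap a` is implied by the crux: it is a consequence-type piece). -/
theorem powerLawFloor_of_conductanceLowerBound (a : ℕ) (h : ConductanceLowerBound) : PowerLawFloor a := by
  rw [conductanceLowerBound_iff_inFrame] at h
  intro ω₂ lam β γ hω hl hβ hγ hu μ hμ T hT D hD
  obtain ⟨c, hc, N₁, hN₁⟩ := h ω₂ lam β γ hω hl hβ hγ hu μ hμ T hT D hD
  refine ⟨c, hc, max N₁ 1, fun N hN => ?_⟩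
  have hN1 : (1 : ℝ) ≤ N := by exact_mod_cast le_of_max_le_right hN
  have hpow : (1 : ℝ) ≤ (N : ℝ) ^ a := one_le_pow₀ hN1
  calc c / (N : ℝ) ^ a ≤ c := div_le_self hc.le hpow
    _ ≤ D N := hN₁ N (le_of_max_le_left hN)

/-- The bridge split assembles trivially: `PowerLawFloor a → Bootstrap a → crux`. -/
theorem conductanceLowerBound_of_powerLawFloor_of_bootstrap (a : ℕ) (hF : PowerLawFloor a) (hB : Bootstrap a) :
    ConductanceLowerBound :=
  hB hF

/-- **WEAK-CONTACT TRANSMISSION at the length-scaled coupling `γ' = γ₀/L`** (census T7 / D-G), in forward-field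
currency: for all parameters `> 0` and `T > 0` there are `γ₀, t₀ > 0`, `L₁` such that for `L ≥ L₁` (`L ≥ 2`) every
classical mean-zero `C² ∩ L²(μ_T)` left forward field `g'` of `pinnedChain ω₂ lam β (γ₀/L)` satisfies
`t₀·T ≤ 4(γ₀/L)²·‖∂_{p_{L−1}} g'‖²`, i.e. the RELATIVE TRANSMISSION `𝒯_L(γ') = 2G_L(γ')/γ' = 4γ'²E(γ')/T` of the weakly
coupled chain stays `≥ t₀` (`𝒯 ∈ [0,1]` always; `𝒯 = 1` = energy injected at one end exits at either end with probability
`½`).  Resistor heuristic: `𝒯 ≈ 2/(γ₀/κ + c₁)` — true iff the bulk is at least diffusive; false for a subdiffusive or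
insulating bulk.  So it is the crux in weak-contact currency, not a weaker statement. -/
def WeakContactTransmission : Prop :=
  ∀ (ω₂ lam β T : ℝ), 0 < ω₂ → 0 < lam → 0 < β → 0 < T →
    ∃ γ₀ : ℝ, 0 < γ₀ ∧ ∃ t₀ : ℝ, 0 < t₀ ∧ ∃ L₁ : ℕ, ∀ (L : ℕ) (hL : 2 ≤ L), L₁ ≤ L →
      ∀ g : PhaseSpace L → ℝ, ContDiff ℝ 2 g →
        MemLp g 2 ((pinnedChain ω₂ lam β (γ₀ / L)).gibbsMeasure L T) →
        ∫ x, g x ∂((pinnedChain ω₂ lam β (γ₀ / L)).gibbsMeasure L T) = 0 →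
        (∀ x, (pinnedChain ω₂ lam β (γ₀ / L)).generator L T T g x = -(kin L 0 x - T)) →
        t₀ * T ≤ 4 * (γ₀ / L) ^ 2 *
          ∫ x, (partialP (⟨L - 1, by omega⟩ : Fin L) g x) ^ 2 ∂((pinnedChain ω₂ lam β (γ₀ / L)).gibbsMeasure L T)

/-- **The scaled weak-contact transfer loses exactly one power of `L`:**
`WeakContactTransmission → PowerLawFloor 1` (census T7 / D-G; PROVED).  Ingredients, all landed: forward fields exist at
every coupling (`stub_plainForwardField`), `D_L(γ) = (L−1)(2γ³/T)E(γ)` along the crux data (`response_eq_dirichlet`),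
and the coupling transfer `γ'⁴E(γ') ≤ γ⁴E(γ)` for `γ' ≤ γ` (`helper_couplingTransfer_farGradient`); hence
`D_L(γ) ≥ (L−1)·γ'²·𝒯_L(γ')/(2γ) ≥ (L−1) γ₀² t₀/(2γL²) ≥ γ₀² t₀/(4γ L)`. -/
theorem powerLawFloor_one_of_weakContactTransmission (hW : WeakContactTransmission) : PowerLawFloor 1 := by
  intro ω₂ lam β γ hω hl hβ hγ hu μ hμ T hT D hD
  obtain ⟨γ₀, hγ₀, t₀, ht₀, L₁, hWL⟩ := hW ω₂ lam β T hω hl hβ hT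
  -- threshold: L ≥ L₁, L ≥ 2, and γ₀/L ≤ γ
  refine ⟨γ₀ ^ 2 * t₀ / (4 * γ), by positivity, max (max L₁ 2) ⌈γ₀ / γ⌉₊, fun L hL => ?_⟩
  have hL1 : L₁ ≤ L := le_trans (le_max_left _ _) (le_of_max_le_left hL)
  have hL2 : 2 ≤ L := le_trans (le_max_right _ _) (le_of_max_le_left hL)
  have hLc : ⌈γ₀ / γ⌉₊ ≤ L := le_of_max_le_right hL
  have hLpos : (0 : ℝ) < L := by exact_mod_cast (show 0 < L by omega)
  have hL2r : (2 : ℝ) ≤ L := by exact_mod_cast hL2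
  set γ' : ℝ := γ₀ / L with hγ'
  have hγ'pos : 0 < γ' := div_pos hγ₀ hLpos
  have hγ'le : γ' ≤ γ := by
    rw [hγ', div_le_iff₀ hLpos]
    have h1 : γ₀ / γ ≤ (⌈γ₀ / γ⌉₊ : ℝ) := Nat.le_ceil _
    have h2 : ((⌈γ₀ / γ⌉₊ : ℕ) : ℝ) ≤ L := by exact_mod_cast hLc
    have h3 : γ₀ / γ ≤ L := h1.trans h2
    have h4 : γ₀ ≤ L * γ := by rwa [div_le_iff₀ hγ] at h3
    calc γ₀ ≤ (L : ℝ) * γ := h4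
      _ = γ * L := mul_comm _ _
  -- forward fields at both couplings
  obtain ⟨g, hgC, hgL2, hg0, hgeq⟩ := stub_plainForwardField ω₂ lam β γ T hω hl hβ hγ hT L hL2
  obtain ⟨g', hg'C, hg'L2, hg'0, hg'eq⟩ := stub_plainForwardField ω₂ lam β γ' T hω hl hβ hγ'pos hT L hL2
  -- the response coefficient of the γ-chain is a Dirichlet energy
  have hDL := response_eq_dirichlet hω hl hβ hγ hT hu hμ hD hL2 hgC hgL2 hg0 hgeq
  -- coupling transfer γ'^4 E' ≤ γ^4 E
  obtain ⟨-, htr⟩ := helper_couplingTransfer_farGradient ω₂ lam β γ' γ T hω hl hβ hγ'pos hγ'le hT L hL2 g' g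
    hg'C hg'L2 hg'0 hg'eq hgC hgL2 hg0 hgeq
  -- the weak-contact transmission floor at γ'
  have hWT := hWL L hL2 hL1 g' hg'C hg'L2 hg'0 hg'eq
  set E : ℝ := ∫ x, (partialP (⟨L - 1, by omega⟩ : Fin L) g x) ^ 2 ∂((pinnedChain ω₂ lam β γ).gibbsMeasure L T)
    with hE
  set E' : ℝ := ∫ x, (partialP (⟨L - 1, by omega⟩ : Fin L) g' x) ^ 2 ∂((pinnedChain ω₂ lam β γ').gibbsMeasure L T)
    with hE'
  have hE0 : 0 ≤ E := integral_nonneg fun x => sq_nonneg _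
  have hE'0 : 0 ≤ E' := integral_nonneg fun x => sq_nonneg _
  -- hDL : D L = (L - 1) * (2 * γ^3 / T * E) ;  htr : γ' ^ 4 * E' ≤ γ ^ 4 * E ;  hWT : t₀ * T ≤ 4 * γ' ^ 2 * E'
  rw [hDL, pow_one]
  have h1 : γ' ^ 2 * (t₀ * T) ≤ 4 * (γ' ^ 4 * E') := by
    calc γ' ^ 2 * (t₀ * T) ≤ γ' ^ 2 * (4 * γ' ^ 2 * E') := mul_le_mul_of_nonneg_left hWT (sq_nonneg γ')
      _ = 4 * (γ' ^ 4 * E') := by ring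
  have h2 : γ' ^ 2 * (t₀ * T) ≤ 4 * (γ ^ 4 * E) := by linarith [htr]
  have hsub : γ' ^ 2 = γ₀ ^ 2 / (L : ℝ) ^ 2 := by rw [hγ', div_pow]
  have hL2pos : (0 : ℝ) < (L : ℝ) ^ 2 := by positivity
  have h3 : γ₀ ^ 2 * (t₀ * T) ≤ 4 * (γ ^ 4 * E) * (L : ℝ) ^ 2 := by
    rw [hsub, div_mul_eq_mul_div, div_le_iff₀ hL2pos] at h2
    exact h2
  have hELnn : 0 ≤ γ ^ 4 * E * (L : ℝ) := by positivity
  have h4 : γ₀ ^ 2 * (t₀ * T) ≤ 8 * γ ^ 4 * E * L * ((L : ℝ) - 1) := by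
    nlinarith [h3, hL2r, hELnn, mul_nonneg hELnn (by linarith : (0 : ℝ) ≤ 2 * ((L : ℝ) - 1) - L)]
  rw [div_div, div_le_iff₀ (by positivity : (0 : ℝ) < 4 * γ * L)]
  have hTne : T ≠ 0 := hT.ne'
  have hRHS : ((L : ℝ) - 1) * (2 * γ ^ 3 / T * E) * (4 * γ * L) = 8 * γ ^ 4 * E * L * ((L : ℝ) - 1) / T := by
    field_simp
    ring
  rw [hRHS, le_div_iff₀ hT]
  linarith [h4]

/-! ## §4 S7 (structural): multiplicative slack in a series law does not give the crux -/

/-- **Multiplicative-slack series laws iterate only to power laws.**  The resistance sequence `R_N = N²` obeys the series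
law with multiplicative slack `K = 2`, `R_{N+M} ≤ 2(R_N + R_M)`, is positive, and yet `D_N := (N−1)/R_N → 0`: so no
statement of the shape "a thermalising cut changes the resistance by at most a FACTOR" can supply the crux; only
additive-slack (`+C`, or `+o(N)` summable along dyadic scales) series laws do, and those are leading-order rate statements
(they pin `R_{N+M}/(R_N+R_M) → 1`), i.e. at least as strong as the two-sided junction locality of route JunctionLocality. -/
theorem multiplicativeSeriesLaw_witness :
    ∃ R : ℕ → ℝ, (∀ N : ℕ, 1 ≤ N → 0 < R N) ∧ (∀ N M : ℕ, R (N + M) ≤ 2 * (R N + R M)) ∧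
      Tendsto (fun N : ℕ => ((N : ℝ) - 1) / R N) atTop (𝓝 0) := by
  refine ⟨fun N => (N : ℝ) ^ 2, ?_, ?_, ?_⟩
  · intro N hN
    have : (1 : ℝ) ≤ N := by exact_mod_cast hN
    positivity
  · intro N M
    push_cast
    nlinarith [sq_nonneg ((N : ℝ) - M)]
  · -- (N - 1)/N² = 1/N - 1/N² for N ≥ 1
    have h1 : Tendsto (fun N : ℕ => (N : ℝ)⁻¹) atTop (𝓝 0) := tendsto_inv_atTop_nhds_zero_nat
    have h2 : Tendsto (fun N : ℕ => (N : ℝ)⁻¹ - (N : ℝ)⁻¹ * (N : ℝ)⁻¹) atTop (𝓝 (0 - 0 * 0)) :=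
      h1.sub (h1.mul h1)
    simp only [sub_zero, mul_zero] at h2
    refine h2.congr' ?_
    filter_upwards [eventually_ge_atTop 1] with N hN
    have hN' : (N : ℝ) ≠ 0 := by exact_mod_cast (show N ≠ 0 by omega)
    field_simp

end Summit.AtomisticToContinuum.FouriersLaw.Cruxes.ConductanceLowerBound.StrategyCensusS2JLb

end
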